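import Mathlib
import HarnessLib
import Literature.MathematicalPhysics.QuantumLattice.SalmhoferCutoffGevrey
import Summits.HubbardSuperconductivity.HubbardSuperconductivity.Theorems.KLProgrammeC4aPPKernelTrueJetsAllOrders

/-!
# Route `KLProgramme` — crux C4a, S3 brick (B4) «(B4)-UMK1», «(U1)-K-JETS-ALL-ORDERS» part 3: the `u`-jets of the pp kernel are JOINTLY CONTINUOUS in the two
# levels at every order — the explicit termwise jet, a level-uniform summable dominator, `continuous_iteratedDeriv_ppTrueKernel₂`

Cell `gate-hubbard-kl`, seat hubbard-kl-k3c3-p1 (g20; row «δμ-flow with klAngularMean constant piece»).  Companion of `…C4aPPKernelTrueJetsCore` (part 1) and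
`…C4aPPKernelTrueJetsAllOrders` (part 2: `|∂ᵤᵏP(e,u)| ≤ (k+1)!·2^{2k+2}·(1+X)·max(Λ,|u|)^{−(k+1)}`).  The order-one law of the (C)-closer lane
(`…C4aFirstOrderLayerSum.firstOrderLayer_abs_le`, k3c3-p3) binds, next to the envelopes `hK0/hK1`, the JOINT continuity row `hKc : Continuous fun p => deriv (Kr p.1) p.2`
(measurability / continuity of the `(e, v)`-integrands); its order-`k` successors for `M₂…M₄` will bind the same for `∂ᵤʲ`, `j ≤ k`.  Here, for `P = ppTrueKernel β Λ`:
* §1 **`iteratedDeriv_ppKernelSummand_eq`** — the explicit Leibniz jet of one summand: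
  `∂ᵤᵏsₙ(e,u) = Σ_{j≤k} C(k,j)·W(ωₙ,e)·∂ᵤʲW(ωₙ,·)(u)·Re[(−iωₙ+e)⁻¹·∏_{i<k−j}(−(1+i))·(iωₙ+u)^{−(k−j+1)}]` (Mathlib `iteratedDeriv_fun_mul` + part 1);
* §2 `continuous_ppKernelSummand_jet₂` — each summand's `k`-th `u`-jet is jointly continuous in `(e,u)`;
* §3 `abs_iteratedDeriv_ppKernelSummand_le_unif₂` — a summable dominator `C·1/ωₙ²` uniform in BOTH levels (crude: `‖(−iω+e)⁻¹‖ ≤ 1/ω`, `‖iω+u‖ ≥ ω`; `β`, `Λ`, `k`, `X` enter `C`);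
* §4 **`continuous_iteratedDeriv_ppTrueKernel₂`**: `Continuous fun p : ℝ × ℝ => iteratedDeriv k (fun v => ppTrueKernel β Λ p.1 v) p.2` for every `k`, the composable form
  `continuous_iteratedDeriv_ppTrueKernel_comp` (`p ↦ ∂ᵤᵏP(f p, ·)(g p)` for continuous `f, g`), and the `k = 1` reading `continuous_deriv_ppTrueKernel₂`
  (`Continuous fun p => deriv (fun v => P p.1 v) p.2` — the row `hKc` verbatim for `Kr := P`), and the bundle `ppTrueKernel_jetRows` (`C^k` ∧ joint continuity
  `∀ j ≤ k` ∧ envelopes `∀ j ≤ k`);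
* §5 HYPOTHESIS-FREE forms through the Literature Gevrey-2 table of `χ₂` (`‖χ₂⁽ˡ⁾‖ ≤ 8·(l!)²·342ˡ`, `SalmhoferCutoffGevrey`):
  **`abs_iteratedDeriv_ppTrueKernel_le_gevrey`** (`|∂ᵤᵏP(e,u)| ≤ (k+1)!·2^{2k+2}·(1 + 8(k!)²342ᵏ)·max(Λ,|u|)^{−(k+1)}` — crude numerals; sharp `sup|χ₂⁽ˡ⁾|` are a
  certified-numerics item, not claimed), `continuous_iteratedDeriv_ppTrueKernel₂'`, `ppTrueKernel_jetRows_gevrey`;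
* §6 **`ppTrueKernel_orderRows`** — THE ORDER-`k` ROWS IN THE LAW CURRENCY of `…C4aPPKernelFirstOrderRows` (`Kr := P/C`, strip `0 < lo ≤ Λ`, box `hi ≤ K·Λ`, `1 ≤ K`,
  any `C ≥ (k+1)!·2^{2k+2}·(1+X)·K^{k+1}`): `C^k` ∧ `∀ j ≤ k` joint continuity of `∂ᵤʲ(P/C)` ∧ `|∂ᵤʲ(P/C)(e,u)| ≤ (max |e| |u|)⁻¹^(j+1)` on the box (`e ≠ 0`) ∧
  `≤ (max lo |u|)⁻¹^(j+1)` on the strip — at `k = 1` the six rows `hKd hKc hK0 hK0s hK1 hKs1` of `firstOrderLayer_abs_le` with `deriv = iteratedDeriv 1`.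
Pure real/complex analysis on landed objects; nothing asserts (C), any engine row, K3, the window or superconductivity.
References: BGM 2006 §2.1 (2.3)–(2.4), §2.4 (2.36) [cite: BenfattoGiulianiMastropietro2006]; Salmhofer 1999 §4.2.5 (4.70)–(4.71) [cite: Salmhofer1999].
-/

noncomputable section

namespace Summit.HubbardSuperconductivity.HubbardSuperconductivity.Theorems.C4a

set_option linter.dupNamespace false -- summit = problem name (single-conjunct summit), D-0017

open Real Filter Set Finset Complex
open scoped Topology Nat
open Literature.MathematicalPhysics.QuantumLattice Literature.Analysis.SpecialFunctions Literature.Analysis.Calculus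

/-! ## §1 The explicit Leibniz jet of one summand -/

/-- **`∂ᵤᵏsₙ(e,u) = Σ_{j≤k} C(k,j)·(W(ωₙ,e)·∂ᵤʲW(ωₙ,·)(u))·Re[(−iωₙ+e)⁻¹·∏_{i<k−j}(−(1+i))·(iωₙ+u)^{−(k−j+1)}]`**. [cite: BenfattoGiulianiMastropietro2006, §2.1 (2.3)-(2.4)] -/
theorem iteratedDeriv_ppKernelSummand_eq {β : ℝ} (hβ : 0 < β) (Λ e : ℝ) (n k : ℕ) (u : ℝ) :
    iteratedDeriv k (fun v : ℝ => ppKernelSummand β Λ e v n) u =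
      ∑ j ∈ Finset.range (k + 1), (k.choose j : ℝ) * (uvWeightFn Λ (ppFreq β n) e * iteratedDeriv j (fun v : ℝ => uvWeightFn Λ (ppFreq β n) v) u) *
        ((-I * ppFreq β n + (e : ℂ))⁻¹ *
          ((∏ i ∈ Finset.range (k - j), (-((0 + 1 + i : ℕ) : ℂ))) * ((I * ppFreq β n + (u : ℂ))⁻¹) ^ (0 + 1 + (k - j)))).re := by
  have hω := ppFreq_pos hβ n
  have hf : ContDiff ℝ k (fun v : ℝ => uvWeightFn Λ (ppFreq β n) e * uvWeightFn Λ (ppFreq β n) v) :=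
    contDiff_const.mul (contDiff_uvWeightFn_band Λ (ppFreq β n))
  have hg : ContDiff ℝ k (fun v : ℝ => (e * v + ppFreq β n ^ 2) / ((ppFreq β n ^ 2 + e ^ 2) * (ppFreq β n ^ 2 + v ^ 2))) :=
    contDiff_pairCore hω.ne' e
  rw [ppKernelSummand_eq_mul_fun, iteratedDeriv_fun_mul hf.contDiffAt hg.contDiffAt]
  refine Finset.sum_congr rfl fun j _ => ?_
  rw [iteratedDeriv_const_mul_field, iteratedDeriv_pairCore_eq hω.ne' e (k - j) u]

/-! ## §2 Joint continuity of the summands' jets -/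

/-- `−iω + e ≠ 0` for real `e`, `ω ≠ 0`. [folklore] -/
theorem neg_I_mul_add_ofReal_ne_zero {ω : ℝ} (hω : ω ≠ 0) (e : ℝ) : (-I * ω + (e : ℂ)) ≠ 0 := by
  intro h
  have := congrArg Complex.im h
  simp at this
  exact hω this

/-- Each summand's `k`-th `u`-jet is jointly continuous in the two levels. [cite: BenfattoGiulianiMastropietro2006, §2.1 (2.3)-(2.4)] -/
theorem continuous_ppKernelSummand_jet₂ {β : ℝ} (hβ : 0 < β) (Λ : ℝ) (n k : ℕ) :
    Continuous fun p : ℝ × ℝ => iteratedDeriv k (fun v : ℝ => ppKernelSummand β Λ p.1 v n) p.2 := by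
  have hω := ppFreq_pos hβ n
  set ω := ppFreq β n with hω_def
  have hfun : (fun p : ℝ × ℝ => iteratedDeriv k (fun v : ℝ => ppKernelSummand β Λ p.1 v n) p.2) = fun p : ℝ × ℝ =>
      ∑ j ∈ Finset.range (k + 1), (k.choose j : ℝ) * (uvWeightFn Λ ω p.1 * iteratedDeriv j (fun v : ℝ => uvWeightFn Λ ω v) p.2) *
        ((-I * ω + (p.1 : ℂ))⁻¹ * ((∏ i ∈ Finset.range (k - j), (-((0 + 1 + i : ℕ) : ℂ))) * ((I * ω + (p.2 : ℂ))⁻¹) ^ (0 + 1 + (k - j)))).re :=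
    funext fun p => iteratedDeriv_ppKernelSummand_eq hβ Λ p.1 n k p.2
  rw [hfun]
  refine continuous_finsetSum _ fun j _ => ?_
  have hW1 : Continuous fun p : ℝ × ℝ => uvWeightFn Λ ω p.1 := (continuous_uvWeightFn_level Λ ω).comp continuous_fst
  have hW2 : Continuous fun p : ℝ × ℝ => iteratedDeriv j (fun v : ℝ => uvWeightFn Λ ω v) p.2 :=
    ((contDiff_uvWeightFn_band Λ ω (N := ⊤)).continuous_iteratedDeriv j (by exact_mod_cast le_top)).comp continuous_snd
  have ha : Continuous fun p : ℝ × ℝ => (-I * ω + (p.1 : ℂ))⁻¹ :=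
    ((continuous_const.add (Complex.continuous_ofReal.comp continuous_fst)).inv₀ fun p => neg_I_mul_add_ofReal_ne_zero hω.ne' p.1)
  have hb : Continuous fun p : ℝ × ℝ => ((I * ω + (p.2 : ℂ))⁻¹) ^ (0 + 1 + (k - j)) :=
    ((continuous_const.add (Complex.continuous_ofReal.comp continuous_snd)).inv₀ fun p => I_mul_add_ofReal_ne_zero hω.ne' p.2).pow _
  have hre : Continuous fun p : ℝ × ℝ =>
      ((-I * ω + (p.1 : ℂ))⁻¹ * ((∏ i ∈ Finset.range (k - j), (-((0 + 1 + i : ℕ) : ℂ))) * ((I * ω + (p.2 : ℂ))⁻¹) ^ (0 + 1 + (k - j)))).re :=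
    Complex.continuous_re.comp (ha.mul (continuous_const.mul hb))
  exact ((continuous_const.mul (hW1.mul hW2)).mul hre)

/-! ## §3 A summable dominator uniform in both levels -/

/-- **`∃ C, ∀ n e u, |∂ᵤᵏsₙ(e,u)| ≤ C·1/ωₙ²`** (crude: `‖(−iωₙ+e)⁻¹‖ ≤ 1/ωₙ`, `‖iωₙ+u‖ ≥ ωₙ`, `1/ωₙ ≤ β/π`; the constant depends on `β, Λ, k, X`, not on the levels).
[folklore] -/
theorem abs_iteratedDeriv_ppKernelSummand_le_unif₂ {β Λ : ℝ} (hβ : 0 < β) (hΛ : 0 < Λ) {k : ℕ} {X : ℝ}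
    (hX : ∀ l ≤ k, ∀ x : ℝ, ‖iteratedFDeriv ℝ l salmhoferCutoff x‖ ≤ X) :
    ∃ C : ℝ, ∀ (n : ℕ) (e u : ℝ), |iteratedDeriv k (fun v : ℝ => ppKernelSummand β Λ e v n) u| ≤ C * (1 / (ppFreq β n ^ 2 + 0 ^ 2)) := by
  have hX0 : 0 ≤ X := zero_le_one.trans (one_le_of_cutoff_jets hX)
  set A : ℝ := max (β / π) 1 with hA_def
  set B : ℝ := max (4 / Λ) 1 with hB_def
  have hA1 : 1 ≤ A := le_max_right _ _
  have hB1 : 1 ≤ B := le_max_right _ _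
  refine ⟨k ! * A ^ k * B ^ k * (1 + k * X), fun n e u => ?_⟩
  have hω := ppFreq_pos hβ n
  set ω := ppFreq β n with hω_def
  have hωA : 1 / ω ≤ A := by
    refine le_trans ?_ (le_max_left _ _)
    rw [div_le_div_iff₀ hω Real.pi_pos, one_mul]
    have := pi_div_le_ppFreq hβ n
    rw [← hω_def, div_le_iff₀ hβ] at this
    linarith
  have hω0 : 0 ≤ 1 / ω := by positivity
  have ha : ‖(-I * ω + (e : ℂ))⁻¹‖ ≤ 1 / ω := by have := norm_inv_neg_I_mul_add_le hω.ne' e; rwa [abs_of_pos hω] at this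
  have hw : 1 / ‖I * ω + (u : ℂ)‖ ≤ 1 / ω := by
    have := norm_inv_I_mul_add_le hω.ne' u; rwa [abs_of_pos hω, norm_inv, inv_eq_one_div] at this
  have hw0 : 0 ≤ 1 / ‖I * ω + (u : ℂ)‖ := by positivity
  have hWe : |uvWeightFn Λ ω e| ≤ 1 := abs_uvWeightFn_le_one _ _ _
  have hsq : (1 / ω) ^ 2 = 1 / (ω ^ 2 + 0 ^ 2) := by rw [zero_pow two_ne_zero, add_zero, one_div_pow]
  refine (abs_iteratedDeriv_ppKernelSummand_le_sum hβ Λ e u n k).trans ?_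
  -- the order-zero term
  have h0 : ‖iteratedDeriv 0 (fun v : ℝ => uvWeightFn Λ ω e * uvWeightFn Λ ω v) u‖ *
        ‖iteratedDeriv k (fun v : ℝ => (e * v + ω ^ 2) / ((ω ^ 2 + e ^ 2) * (ω ^ 2 + v ^ 2))) u‖ ≤ k ! * A ^ k * B ^ k * (1 / (ω ^ 2 + 0 ^ 2)) := by
    rw [iteratedDeriv_zero, norm_mul, Real.norm_eq_abs, Real.norm_eq_abs, Real.norm_eq_abs]
    have hc := abs_iteratedDeriv_pairCore_le_crude hω e k u
    calc |uvWeightFn Λ ω e| * |uvWeightFn Λ ω u| * |iteratedDeriv k (fun v : ℝ => (e * v + ω ^ 2) / ((ω ^ 2 + e ^ 2) * (ω ^ 2 + v ^ 2))) u|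
        ≤ 1 * 1 * (k ! * (1 / ω) * (1 / ω) ^ (k + 1)) := by
          gcongr
          · exact abs_uvWeightFn_le_one _ _ _
          · exact hc.trans (by gcongr)
      _ = k ! * (1 / ω) ^ k * 1 * (1 / ω) ^ 2 := by ring
      _ ≤ k ! * A ^ k * B ^ k * (1 / ω) ^ 2 := by gcongr; exact one_le_pow₀ hB1
      _ = k ! * A ^ k * B ^ k * (1 / (ω ^ 2 + 0 ^ 2)) := by rw [hsq]
  -- the shell terms, crudely
  have hS : ∀ i ∈ Finset.range k, (k.choose (i + 1) : ℝ) *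
        ‖iteratedDeriv (i + 1) (fun v : ℝ => uvWeightFn Λ ω e * uvWeightFn Λ ω v) u‖ *
        ‖iteratedDeriv (k - (i + 1)) (fun v : ℝ => (e * v + ω ^ 2) / ((ω ^ 2 + e ^ 2) * (ω ^ 2 + v ^ 2))) u‖ ≤
      k ! * A ^ k * B ^ k * X * (1 / (ω ^ 2 + 0 ^ 2)) := by
    intro i hi
    have hik : i + 1 ≤ k := Finset.mem_range.1 hi
    have hW : ‖iteratedDeriv (i + 1) (fun v : ℝ => uvWeightFn Λ ω e * uvWeightFn Λ ω v) u‖ ≤ 1 * ((i + 1)! * X * (4 / Λ) ^ (i + 1)) := by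
      rw [iteratedDeriv_const_mul_field, norm_mul, Real.norm_eq_abs, Real.norm_eq_abs]
      exact mul_le_mul hWe (abs_iteratedDeriv_uvWeightFn_le hΛ ω (fun l hl x => hX l (by omega) x) u) (abs_nonneg _) zero_le_one
    have hC : ‖iteratedDeriv (k - (i + 1)) (fun v : ℝ => (e * v + ω ^ 2) / ((ω ^ 2 + e ^ 2) * (ω ^ 2 + v ^ 2))) u‖ ≤
        (k - (i + 1))! * (1 / ω) * (1 / ω) ^ (k - (i + 1) + 1) := by
      rw [Real.norm_eq_abs]
      exact (abs_iteratedDeriv_pairCore_le_crude hω e _ u).trans (by gcongr)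
    have hchoose : (k.choose (i + 1) : ℝ) * ((i + 1)! : ℝ) * ((k - (i + 1))! : ℝ) = k ! := by
      have := Nat.choose_mul_factorial_mul_factorial hik
      exact_mod_cast this
    have hB' : (4 / Λ) ^ (i + 1) ≤ B ^ k :=
      (pow_le_pow_left₀ (by positivity) (le_max_left _ _) _).trans (pow_le_pow_right₀ hB1 hik)
    have hA' : (1 / ω) ^ (k - (i + 1)) ≤ A ^ k := (pow_le_pow_left₀ hω0 hωA _).trans (pow_le_pow_right₀ hA1 (Nat.sub_le _ _))
    calc (k.choose (i + 1) : ℝ) * ‖iteratedDeriv (i + 1) (fun v : ℝ => uvWeightFn Λ ω e * uvWeightFn Λ ω v) u‖ *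
          ‖iteratedDeriv (k - (i + 1)) (fun v : ℝ => (e * v + ω ^ 2) / ((ω ^ 2 + e ^ 2) * (ω ^ 2 + v ^ 2))) u‖
        ≤ (k.choose (i + 1) : ℝ) * (1 * ((i + 1)! * X * (4 / Λ) ^ (i + 1))) * ((k - (i + 1))! * (1 / ω) * (1 / ω) ^ (k - (i + 1) + 1)) := by
          gcongr
      _ = ((k.choose (i + 1) : ℝ) * ((i + 1)! : ℝ) * ((k - (i + 1))! : ℝ)) * X * ((4 / Λ) ^ (i + 1) * (1 / ω) ^ (k - (i + 1))) * (1 / ω) ^ 2 := by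
          ring
      _ ≤ (k ! : ℝ) * X * (B ^ k * A ^ k) * (1 / ω) ^ 2 := by rw [hchoose]; gcongr
      _ = k ! * A ^ k * B ^ k * X * (1 / (ω ^ 2 + 0 ^ 2)) := by rw [hsq]; ring
  have hS' := Finset.sum_le_sum hS
  rw [Finset.sum_const, Finset.card_range, nsmul_eq_mul] at hS'
  calc _ ≤ k ! * A ^ k * B ^ k * (1 / (ω ^ 2 + 0 ^ 2)) + k * (k ! * A ^ k * B ^ k * X * (1 / (ω ^ 2 + 0 ^ 2))) := add_le_add h0 hS'
    _ = k ! * A ^ k * B ^ k * (1 + k * X) * (1 / (ω ^ 2 + 0 ^ 2)) := by ring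

/-! ## §4 Joint continuity of the kernel's jets -/

/-- **The `u`-jets of `P` are jointly continuous in the two levels, at every order**:
`Continuous fun p : ℝ × ℝ => iteratedDeriv k (fun v => ppTrueKernel β Λ p.1 v) p.2`. [cite: BenfattoGiulianiMastropietro2006, §2.4 (2.36)] -/
theorem continuous_iteratedDeriv_ppTrueKernel₂ {β Λ : ℝ} (hβ : 0 < β) (hΛ : 0 < Λ) {k : ℕ} {X : ℝ}
    (hX : ∀ l ≤ k, ∀ x : ℝ, ‖iteratedFDeriv ℝ l salmhoferCutoff x‖ ≤ X) :
    Continuous fun p : ℝ × ℝ => iteratedDeriv k (fun v : ℝ => ppTrueKernel β Λ p.1 v) p.2 := by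
  have hfun : (fun p : ℝ × ℝ => iteratedDeriv k (fun v : ℝ => ppTrueKernel β Λ p.1 v) p.2) =
      fun p : ℝ × ℝ => 2 / β * ∑' n : ℕ, iteratedDeriv k (fun v : ℝ => ppKernelSummand β Λ p.1 v n) p.2 :=
    funext fun p => iteratedDeriv_ppTrueKernel_eq_tsum hβ hΛ hX p.1 p.2
  rw [hfun]
  obtain ⟨C, hC⟩ := abs_iteratedDeriv_ppKernelSummand_le_unif₂ hβ hΛ hX
  refine continuous_const.mul ?_
  exact continuous_tsum (fun n => continuous_ppKernelSummand_jet₂ hβ Λ n k) ((summable_one_div_ppFreq_sq_add_sq hβ 0).mul_left C)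
    fun n p => by rw [Real.norm_eq_abs]; exact hC n p.1 p.2

/-- Composable form: `p ↦ ∂ᵤᵏP(f p, ·)(g p)` is continuous for continuous `f, g`. [cite: BenfattoGiulianiMastropietro2006, §2.4 (2.36)] -/
theorem continuous_iteratedDeriv_ppTrueKernel_comp {β Λ : ℝ} (hβ : 0 < β) (hΛ : 0 < Λ) {k : ℕ} {X : ℝ}
    (hX : ∀ l ≤ k, ∀ x : ℝ, ‖iteratedFDeriv ℝ l salmhoferCutoff x‖ ≤ X) {Y : Type*} [TopologicalSpace Y] {f g : Y → ℝ}
    (hf : Continuous f) (hg : Continuous g) :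
    Continuous fun y : Y => iteratedDeriv k (fun v : ℝ => ppTrueKernel β Λ (f y) v) (g y) := by
  have h2 : Continuous fun y : Y => ((f y, g y) : ℝ × ℝ) := hf.prodMk hg
  have h := (continuous_iteratedDeriv_ppTrueKernel₂ hβ hΛ hX (k := k)).comp h2
  simpa only [Function.comp_def] using h

/-- **The `k = 1` reading** — the order-one law's row `hKc` for `Kr := P`: `Continuous fun p : ℝ × ℝ => deriv (fun v => ppTrueKernel β Λ p.1 v) p.2`.
[cite: BenfattoGiulianiMastropietro2006, §2.4 (2.36)] -/
theorem continuous_deriv_ppTrueKernel₂ {β Λ : ℝ} (hβ : 0 < β) (hΛ : 0 < Λ) {X : ℝ}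
    (hX : ∀ l ≤ 1, ∀ x : ℝ, ‖iteratedFDeriv ℝ l salmhoferCutoff x‖ ≤ X) :
    Continuous fun p : ℝ × ℝ => deriv (fun v : ℝ => ppTrueKernel β Λ p.1 v) p.2 := by
  have h := continuous_iteratedDeriv_ppTrueKernel₂ hβ hΛ hX (k := 1)
  simpa only [iteratedDeriv_one] using h

/-- **All rows at once, order `k`**: `u ↦ P(e,u)` is `C^k`, its `j`-th `u`-jets (`j ≤ k`) are jointly continuous and obey
`|∂ᵤʲP(e,u)| ≤ (j+1)!·2^{2j+2}·(1+X)·max(Λ,|u|)^{−(j+1)}` — the order-`k` analogue of the bundle `hKd, hKc, hK0, hK1` of the order-one law.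
[cite: BenfattoGiulianiMastropietro2006, §2.4 (2.36)] -/
theorem ppTrueKernel_jetRows {β Λ : ℝ} (hβ : 0 < β) (hΛ : 0 < Λ) {k : ℕ} {X : ℝ}
    (hX : ∀ l ≤ k, ∀ x : ℝ, ‖iteratedFDeriv ℝ l salmhoferCutoff x‖ ≤ X) :
    (∀ e : ℝ, ContDiff ℝ k (fun v : ℝ => ppTrueKernel β Λ e v)) ∧
      (∀ j ≤ k, Continuous fun p : ℝ × ℝ => iteratedDeriv j (fun v : ℝ => ppTrueKernel β Λ p.1 v) p.2) ∧
      (∀ j ≤ k, ∀ e u : ℝ, |iteratedDeriv j (fun v : ℝ => ppTrueKernel β Λ e v) u| ≤ (j + 1)! * 2 ^ (2 * j + 2) * (1 + X) * (1 / max Λ |u|) ^ (j + 1)) :=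
  ⟨fun e => contDiff_ppTrueKernel_u hβ hΛ e,
    fun _ hj => continuous_iteratedDeriv_ppTrueKernel₂ hβ hΛ fun l hl x => hX l (hl.trans hj) x,
    fun _ hj e u => abs_iteratedDeriv_ppTrueKernel_le hβ hΛ (fun l hl x => hX l (hl.trans hj) x) e u⟩

/-! ## §5 Hypothesis-free forms through the Gevrey-2 table of the cutoff -/

/-- The Literature Gevrey table, flattened to order `k`: `∀ l ≤ k, ‖χ₂⁽ˡ⁾‖ ≤ 8·(k!)²·342ᵏ`. [cite: DisertoriRivasseau2000, §II.2 (II.14) footnote] -/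
theorem salmhoferCutoff_jets_le_flat (k : ℕ) :
    ∀ l ≤ k, ∀ x : ℝ, ‖iteratedFDeriv ℝ l salmhoferCutoff x‖ ≤ 8 * ((k ! : ℝ)) ^ 2 * (342 : ℝ) ^ k := by
  intro l hl x
  refine (norm_iteratedFDeriv_salmhoferCutoff_le_gevrey l x).trans ?_
  have hfac : ((l ! : ℝ)) ≤ k ! := by exact_mod_cast Nat.factorial_le hl
  have hpow : (342 : ℝ) ^ l ≤ 342 ^ k := pow_le_pow_right₀ (by norm_num) hl
  gcongr

/-- **HYPOTHESIS-FREE ENVELOPE**: `|∂ᵤᵏ P(e,u)| ≤ (k+1)!·2^{2k+2}·(1 + 8·(k!)²·342ᵏ)·max(Λ,|u|)^{−(k+1)}` for all `k, e, u` (`0 < β`, `0 < Λ`); the numerals are the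
crude Gevrey ones (sharp `sup|χ₂⁽ˡ⁾|` would be a certified-numerics item). [cite: BenfattoGiulianiMastropietro2006, §2.4 (2.36)] -/
theorem abs_iteratedDeriv_ppTrueKernel_le_gevrey {β Λ : ℝ} (hβ : 0 < β) (hΛ : 0 < Λ) (k : ℕ) (e u : ℝ) :
    |iteratedDeriv k (fun v : ℝ => ppTrueKernel β Λ e v) u| ≤
      (k + 1)! * 2 ^ (2 * k + 2) * (1 + 8 * ((k ! : ℝ)) ^ 2 * (342 : ℝ) ^ k) * (1 / max Λ |u|) ^ (k + 1) :=
  abs_iteratedDeriv_ppTrueKernel_le hβ hΛ (salmhoferCutoff_jets_le_flat k) e u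

/-- Hypothesis-free joint continuity of the `k`-th `u`-jet. [cite: BenfattoGiulianiMastropietro2006, §2.4 (2.36)] -/
theorem continuous_iteratedDeriv_ppTrueKernel₂' {β Λ : ℝ} (hβ : 0 < β) (hΛ : 0 < Λ) (k : ℕ) :
    Continuous fun p : ℝ × ℝ => iteratedDeriv k (fun v : ℝ => ppTrueKernel β Λ p.1 v) p.2 :=
  continuous_iteratedDeriv_ppTrueKernel₂ hβ hΛ (salmhoferCutoff_jets_le_flat k)

/-- **Hypothesis-free bundle at order `k`**: `C^k` in `u`, jointly continuous jets, Gevrey-numeral envelopes `∀ j ≤ k`. [cite: BenfattoGiulianiMastropietro2006, §2.4 (2.36)] -/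
theorem ppTrueKernel_jetRows_gevrey {β Λ : ℝ} (hβ : 0 < β) (hΛ : 0 < Λ) (k : ℕ) :
    (∀ e : ℝ, ContDiff ℝ k (fun v : ℝ => ppTrueKernel β Λ e v)) ∧
      (∀ j ≤ k, Continuous fun p : ℝ × ℝ => iteratedDeriv j (fun v : ℝ => ppTrueKernel β Λ p.1 v) p.2) ∧
      (∀ j ≤ k, ∀ e u : ℝ, |iteratedDeriv j (fun v : ℝ => ppTrueKernel β Λ e v) u| ≤
        (j + 1)! * 2 ^ (2 * j + 2) * (1 + 8 * ((k ! : ℝ)) ^ 2 * (342 : ℝ) ^ k) * (1 / max Λ |u|) ^ (j + 1)) :=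
  ppTrueKernel_jetRows hβ hΛ (salmhoferCutoff_jets_le_flat k)

/-! ## §6 The order-`k` rows in the law currency -/

/-- Monotonicity of the headline constant in the order: `(j+1)!·2^{2j+2}·(1+X)·K^{j+1} ≤ (k+1)!·2^{2k+2}·(1+X)·K^{k+1}` for `j ≤ k`, `1 ≤ K`, `0 ≤ X`. [folklore] -/
theorem headlineConst_mono {j k : ℕ} (hjk : j ≤ k) {X K : ℝ} (hX : 0 ≤ X) (hK : 1 ≤ K) :
    ((j + 1)! : ℝ) * 2 ^ (2 * j + 2) * (1 + X) * K ^ (j + 1) ≤ (k + 1)! * 2 ^ (2 * k + 2) * (1 + X) * K ^ (k + 1) := by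
  have h1 : ((j + 1)! : ℝ) ≤ (k + 1)! := by exact_mod_cast Nat.factorial_le (by omega)
  have h2 : (2 : ℝ) ^ (2 * j + 2) ≤ 2 ^ (2 * k + 2) := pow_le_pow_right₀ (by norm_num) (by omega)
  have h3 : K ^ (j + 1) ≤ K ^ (k + 1) := pow_le_pow_right₀ hK (by omega)
  gcongr

/-- **THE ORDER-`k` ROWS OF `P/C` IN THE LAW CURRENCY** (strip `0 < lo ≤ Λ`, level box `hi ≤ K·Λ`, `1 ≤ K`, any `C ≥ (k+1)!·2^{2k+2}·(1+X)·K^{k+1}`):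
`u ↦ P(e,u)/C` is `C^k`; for every `j ≤ k` its `j`-th `u`-jet is jointly continuous in `(e,u)`, `≤ (max |e| |u|)⁻¹^(j+1)` on the box (`e ≠ 0`) and
`≤ (max lo |u|)⁻¹^(j+1)` on the strip `|e| ≤ lo`.  At `k = 1` (`iteratedDeriv 1 = deriv`) these are the six kernel rows of `firstOrderLayer_abs_le`.
[cite: BenfattoGiulianiMastropietro2006, §2.4 (2.36)] -/
theorem ppTrueKernel_orderRows {β Λ : ℝ} (hβ : 0 < β) (hΛ : 0 < Λ) {k : ℕ} {X : ℝ}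
    (hX : ∀ l ≤ k, ∀ x : ℝ, ‖iteratedFDeriv ℝ l salmhoferCutoff x‖ ≤ X) {lo hi K C : ℝ} (hlo : 0 < lo) (hloΛ : lo ≤ Λ) (hK : 1 ≤ K)
    (hhiK : hi ≤ K * Λ) (hC : 0 < C) (hCk : (k + 1)! * 2 ^ (2 * k + 2) * (1 + X) * K ^ (k + 1) ≤ C) :
    (∀ e : ℝ, ContDiff ℝ k (fun v : ℝ => ppTrueKernel β Λ e v / C)) ∧
      (∀ j ≤ k, Continuous fun p : ℝ × ℝ => iteratedDeriv j (fun v : ℝ => ppTrueKernel β Λ p.1 v / C) p.2) ∧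
      (∀ j ≤ k, ∀ e ∈ Icc (-hi) hi, e ≠ 0 → ∀ u : ℝ, |iteratedDeriv j (fun v : ℝ => ppTrueKernel β Λ e v / C) u| ≤ (max |e| |u|)⁻¹ ^ (j + 1)) ∧
      (∀ j ≤ k, ∀ e ∈ Icc (-lo) lo, ∀ u : ℝ, |iteratedDeriv j (fun v : ℝ => ppTrueKernel β Λ e v / C) u| ≤ (max lo |u|)⁻¹ ^ (j + 1)) := by
  have hX0 : 0 ≤ X := zero_le_one.trans (one_le_of_cutoff_jets hX)
  have hXj : ∀ j ≤ k, ∀ l ≤ j, ∀ x : ℝ, ‖iteratedFDeriv ℝ l salmhoferCutoff x‖ ≤ X := fun j hj l hl x => hX l (hl.trans hj) x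
  -- the generic floor row, divided by `C`
  have hrow : ∀ j ≤ k, ∀ {m : ℝ}, 0 < m → m ≤ K * Λ → ∀ e u : ℝ,
      |iteratedDeriv j (fun v : ℝ => ppTrueKernel β Λ e v / C) u| ≤ (max m |u|)⁻¹ ^ (j + 1) := by
    intro j hj m hm hmK e u
    rw [iteratedDeriv_div_const, abs_div, abs_of_pos hC, div_le_iff₀ hC, ← one_div]
    refine (abs_iteratedDeriv_ppTrueKernel_le_of_floor hβ hΛ (hXj j hj) hm hK hmK e u).trans ?_
    rw [mul_comm]
    exact mul_le_mul_of_nonneg_left ((headlineConst_mono hj hX0 hK).trans hCk) (by positivity)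
  refine ⟨fun e => (contDiff_ppTrueKernel_u hβ hΛ e).div_const C, fun j hj => ?_, fun j hj e he hne u => ?_, fun j hj e he u => ?_⟩
  · have h : (fun p : ℝ × ℝ => iteratedDeriv j (fun v : ℝ => ppTrueKernel β Λ p.1 v / C) p.2) =
        fun p => iteratedDeriv j (fun v : ℝ => ppTrueKernel β Λ p.1 v) p.2 / C := funext fun p => by rw [iteratedDeriv_div_const]
    rw [h]
    exact (continuous_iteratedDeriv_ppTrueKernel₂ hβ hΛ (hXj j hj)).div_const C
  · have hehi : |e| ≤ hi := abs_le.2 ⟨he.1, he.2⟩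
    exact hrow j hj (abs_pos.2 hne) (hehi.trans hhiK) e u
  · have hloK : lo ≤ K * Λ := hloΛ.trans (by nlinarith)
    exact hrow j hj hlo hloK e u

end Summit.HubbardSuperconductivity.HubbardSuperconductivity.Theorems.C4a

end
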